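import Summits.FinalStateConjecture.FinalStateConjecture.Theorems.SpacelikeNormalFieldCoord
import Literature.Geometry.Lorentzian.CauchyDevelopmentOneJet
import HarnessLib

/-!
# The future unit normal field of a smooth spacelike hypersurface — unbundled (Part 2 of 2)

For a spacetime `𝒮 = (M, g, τ)` of dimension `n + 1` (`Literature.Geometry.Lorentzian.Spacetime`) and a smooth map
`f : X → M` from an `n`-manifold whose differential is positive definite for `g` (`0 < g(df v, df v)` for `v ≠ 0`; e.g. a
spacelike immersion, `PseudoRiemannianMetric.IsSpacelikeImmersion`), Part 1 (`SpacelikeNormalFieldCoord.lean`)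
constructs THE future unit normal field `futureUnitNormal 𝒮 f : Π x, T_{f x} M` by Gram–Schmidt against the orienting
field read in trivialisations; this Part 2 proves

* `coordMetric_coordNormal_self_neg`, `coordUnitNormal_spec`, `smoothNormal_spec` — `N` is timelike, the normalised
  and transported field is a future unit normal at the points of the two chart domains;
* `isFutureUnitNormal_futureUnitNormal` — `futureUnitNormal` is a future unit normal along `f`
  (`LorentzianMetric.IsFutureUnitNormal`: `g(ν, df v) = 0`, `g(ν, ν) = -1`, `ν` future-directed);
* `eq_futureUnitNormal` — uniqueness: every future unit normal field along `f` is this one;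
* `contMDiffAt_futureUnitNormal` / `contMDiff_futureUnitNormal` — it is `C^∞` as a map `X → TM` (near `x₀` the
  transported field equals `futureUnitNormal` by uniqueness, `TimeOrientation.eq_of_isFutureUnitNormal`);
* `exists_isFutureUnitNormal_contMDiff` — packaged existence statement, and the `IsSpacelikeImmersion` corollaries
  (`val_mfderiv_pos_of_isSpacelikeImmersion`, `exists_isFutureUnitNormal_contMDiff_of_isSpacelikeImmersion`,
  `eq_futureUnitNormal_of_isSpacelikeImmersion`).

Used by the route `RootDecompTrappedGauge` (re-slicing: a smooth spacelike Cauchy hypersurface carries its future unit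
normal with `C^∞` lift, so the re-slicing door need not ask for it). No named facts are introduced. Split of the single
592-line HOME file of `decomp-fsc` lens-4 g25 (packet B) at the census desk's request (lint `statement-form`: Theorems
files with proofs ≤ 400 lines); no statement or proof was changed — the section-variable context of Part 1 at the cut
(`𝒮` explicit; `f`, `x₀` implicit; `hf` declared, not included; `hpos` declared and included) is re-declared verbatim.

## References

* B. O'Neill, *Semi-Riemannian geometry with applications to relativity*, Academic Press 1983, Ch. 4, p. 99 and
  Lemma 4.19 ff. (local unit normal fields of semi-Riemannian hypersurfaces), Ch. 5, Lemma 5.26 and p. 145.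
* R. M. Wald, *General Relativity*, 1984, §10.2 (the unit normal `n^a` of a spacelike hypersurface).
-/

noncomputable section

open Bundle Set Function Filter Module
open Literature.Geometry.Lorentzian
open scoped Manifold ContDiff Topology
open Summit.FinalStateConjecture.FinalStateConjecture.Theorems.SpacelikeNormalFieldCoord

set_option linter.dupNamespace false

-- D-0017: the namespace mirrors the Theorems path of this file (dupNamespace linter off above).
namespace Summit.FinalStateConjecture.FinalStateConjecture.Theorems.SpacelikeNormalField

universe u v

variable {n : ℕ} {X' : Type u} [TopologicalSpace X'] [ChartedSpace (EuclideanSpace ℝ (Fin n)) X']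
  [IsManifold (𝓡 n) ∞ X'] (𝒮 : Spacetime.{v} (n + 1)) {f : X' → 𝒮.carrier} {x₀ : X'}
  (hf : ContMDiff (𝓡 n) (𝓡 (n + 1)) ∞ f)

/- Positive-definiteness hypothesis on the differential: `0 < g(df v, df v)` for `v ≠ 0` (holds for spacelike immersions,
`val_mfderiv_pos_of_isSpacelikeImmersion`). -/
variable (hpos : ∀ (x : X') (v : TangentSpace (𝓡 n) x), v ≠ 0 →
  0 < 𝒮.metric.val (f x) (mfderiv (𝓡 n) (𝓡 (n + 1)) f x v) (mfderiv (𝓡 n) (𝓡 (n + 1)) f x v))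
include hpos

/-! ### Pointwise algebra at the points of the two chart domains (continued) -/

omit hpos [TopologicalSpace X'] [ChartedSpace (EuclideanSpace ℝ (Fin n)) X'] [IsManifold (𝓡 n) ∞ X'] in
/-- `Ĝ(x)(T̂, T̂) = g(T, T) < 0`. [folklore] -/
theorem coordMetric_coordTime_self_neg {x : X'}
    (hxM : f x ∈ (chartAt (EuclideanSpace ℝ (Fin (n + 1))) (f x₀)).source) :
    coordMetric 𝒮 f x₀ x (coordTime 𝒮 f x₀ x) (coordTime 𝒮 f x₀ x) < 0 := by
  rw [coordMetric_apply, symmL_coordTime 𝒮 hxM]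
  exact 𝒮.timeOrientation.isTimelike (f x)

/-- **`N` is timelike**: `Ĝ(x)(N, N) < 0`. [cite: ONeill1983, Ch. 5, Lemma 5.26] -/
theorem coordMetric_coordNormal_self_neg {x : X'}
    (hxX : x ∈ (chartAt (EuclideanSpace ℝ (Fin n)) x₀).source)
    (hxM : f x ∈ (chartAt (EuclideanSpace ℝ (Fin (n + 1))) (f x₀)).source) :
    coordMetric 𝒮 f x₀ x (coordNormal 𝒮 f x₀ x) (coordNormal 𝒮 f x₀ x) < 0 := by
  rw [coordMetric_coordNormal_self 𝒮 hpos hxX hxM]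
  linarith [coordMetric_coordTime_self_neg 𝒮 (x₀ := x₀) hxM, coordGram_nonneg 𝒮 hpos hxM (coordCoeff 𝒮 f x₀ x)]

/-- `Ĝ(x)(T̂, N) = Ĝ(x)(N, N)`. [folklore] -/
theorem coordMetric_coordTime_coordNormal {x : X'}
    (hxX : x ∈ (chartAt (EuclideanSpace ℝ (Fin n)) x₀).source)
    (hxM : f x ∈ (chartAt (EuclideanSpace ℝ (Fin (n + 1))) (f x₀)).source) :
    coordMetric 𝒮 f x₀ x (coordTime 𝒮 f x₀ x) (coordNormal 𝒮 f x₀ x) =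
      coordMetric 𝒮 f x₀ x (coordNormal 𝒮 f x₀ x) (coordNormal 𝒮 f x₀ x) := by
  rw [coordMetric_coordNormal_self 𝒮 hpos hxX hxM]
  rw [coordNormal, map_sub, ← coordFunctional_apply, coordGram_coordCoeff 𝒮 hpos hxX hxM]

/-- **The unit normal read in the trivialisation is a future unit normal**: `Ĝ(ν̂, P w) = 0`, `Ĝ(ν̂, ν̂) = -1`,
`Ĝ(T̂, ν̂) < 0`. [cite: ONeill1983, Ch. 4, Lemma 4.19 ff.] -/
theorem coordUnitNormal_spec {x : X'}
    (hxX : x ∈ (chartAt (EuclideanSpace ℝ (Fin n)) x₀).source)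
    (hxM : f x ∈ (chartAt (EuclideanSpace ℝ (Fin (n + 1))) (f x₀)).source) :
    (∀ w, coordMetric 𝒮 f x₀ x (coordUnitNormal 𝒮 f x₀ x) (coordDeriv 𝒮 f x₀ x w) = 0) ∧
      coordMetric 𝒮 f x₀ x (coordUnitNormal 𝒮 f x₀ x) (coordUnitNormal 𝒮 f x₀ x) = -1 ∧
      coordMetric 𝒮 f x₀ x (coordTime 𝒮 f x₀ x) (coordUnitNormal 𝒮 f x₀ x) < 0 := by
  set a := coordMetric 𝒮 f x₀ x (coordNormal 𝒮 f x₀ x) (coordNormal 𝒮 f x₀ x) with ha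
  have haneg : a < 0 := coordMetric_coordNormal_self_neg 𝒮 hpos hxX hxM
  set r := Real.sqrt (-a) with hr
  have hrpos : 0 < r := Real.sqrt_pos.2 (by linarith)
  have hrsq : r * r = -a := Real.mul_self_sqrt (by linarith)
  have hunit : coordUnitNormal 𝒮 f x₀ x = r⁻¹ • coordNormal 𝒮 f x₀ x := rfl
  have hr0 : r ≠ 0 := hrpos.ne'
  refine ⟨fun w ↦ ?_, ?_, ?_⟩
  · simp only [hunit, map_smul, FunLike.coe_smul, Pi.smul_apply, smul_eq_mul,
      coordMetric_coordNormal_coordDeriv 𝒮 hpos hxX hxM, mul_zero]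
  · simp only [hunit, map_smul, FunLike.coe_smul, Pi.smul_apply, smul_eq_mul]
    rw [← ha]
    field_simp
    linarith
  · simp only [hunit, map_smul, smul_eq_mul]
    rw [coordMetric_coordTime_coordNormal 𝒮 hpos hxX hxM, ← ha]
    exact mul_neg_of_pos_of_neg (inv_pos.2 hrpos) haneg

/-- **The transported unit normal `ν̃(x)` is a future unit normal at `f x`** (in `T_{f x} M`): `g(ν̃, df v) = 0`,
`g(ν̃, ν̃) = -1`, `ν̃` future-directed. [cite: ONeill1983, Ch. 4, Lemma 4.19 ff. and Ch. 5, p. 145] -/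
theorem smoothNormal_spec {x : X'}
    (hxX : x ∈ (chartAt (EuclideanSpace ℝ (Fin n)) x₀).source)
    (hxM : f x ∈ (chartAt (EuclideanSpace ℝ (Fin (n + 1))) (f x₀)).source) :
    (∀ v : TangentSpace (𝓡 n) x, 𝒮.metric.val (f x) (smoothNormal 𝒮 f x₀ x)
        (mfderiv (𝓡 n) (𝓡 (n + 1)) f x v) = 0) ∧
      𝒮.metric.val (f x) (smoothNormal 𝒮 f x₀ x) (smoothNormal 𝒮 f x₀ x) = -1 ∧
      𝒮.timeOrientation.IsFutureDirected (smoothNormal 𝒮 f x₀ x) := by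
  obtain ⟨hN, hunit, hfut⟩ := coordUnitNormal_spec 𝒮 hpos hxX hxM
  have hbX := DataEmbedding.mem_baseSet_of_mem' (x₀ := x₀) hxX
  have huJ : ∀ v : TangentSpace (𝓡 n) x, 𝒮.metric.val (f x) (smoothNormal 𝒮 f x₀ x)
      (mfderiv (𝓡 n) (𝓡 (n + 1)) f x v) = 0 := fun v ↦ by
    have hv : v = (trivializationAt (EuclideanSpace ℝ (Fin n)) (TangentSpace (𝓡 n) : X' → Type _) x₀).symmL ℝ x
        ((trivializationAt (EuclideanSpace ℝ (Fin n)) (TangentSpace (𝓡 n) : X' → Type _) x₀).continuousLinearMapAt ℝ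
          x v) :=
      (Trivialization.symmL_continuousLinearMapAt _ hbX v).symm
    rw [hv, ← symmL_coordDeriv 𝒮 hxM, smoothNormal, ← coordMetric_apply]
    exact hN _
  have huu : 𝒮.metric.val (f x) (smoothNormal 𝒮 f x₀ x) (smoothNormal 𝒮 f x₀ x) = -1 := by
    rw [smoothNormal, ← coordMetric_apply]
    exact hunit
  have hu : 𝒮.timeOrientation.IsFutureDirected (smoothNormal 𝒮 f x₀ x) := by
    have ht : 𝒮.metric.val (f x) (𝒮.timeOrientation.vectorField (f x)) (smoothNormal 𝒮 f x₀ x) < 0 := by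
      rw [← symmL_coordTime 𝒮 hxM, smoothNormal, ← coordMetric_apply]
      exact hfut
    refine ⟨⟨?_, fun h0 ↦ ?_⟩, ht⟩
    · exact le_of_lt (huu.trans_lt (by norm_num))
    · rw [h0, map_zero] at ht
      exact lt_irrefl _ ht
  exact ⟨huJ, huu, hu⟩

/-- **The future unit normal field is a future unit normal along `f`.**
[cite: ONeill1983, Ch. 4, Lemma 4.19 ff.; Ch. 5, Lemma 5.26 and p. 145] [cite: Wald1984, §10.2] -/
theorem isFutureUnitNormal_futureUnitNormal :
    𝒮.metric.IsFutureUnitNormal (𝓡 n) 𝒮.timeOrientation f (futureUnitNormal 𝒮 f) := by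
  refine ⟨⟨fun x v ↦ ?_, fun x ↦ ?_⟩, fun x ↦ ?_⟩
  · exact (smoothNormal_spec 𝒮 hpos (x₀ := x) (mem_chart_source _ x) (mem_chart_source _ (f x))).1 v
  · exact (smoothNormal_spec 𝒮 hpos (x₀ := x) (mem_chart_source _ x) (mem_chart_source _ (f x))).2.1
  · exact (smoothNormal_spec 𝒮 hpos (x₀ := x) (mem_chart_source _ x) (mem_chart_source _ (f x))).2.2

-- (census desk, dedup cure `dedup.landed`: the dimension count `dim T_x X + 1 = dim ℝⁿ⁺¹` is the landed
-- `Literature.Geometry.Lorentzian.DataEmbedding.finrank_tangentSpace_add_one` (module `CauchyDevelopmentOneJet`);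
-- the verbatim local copy of lens-4's packet was deleted and its two call sites below cite the landed declaration.)

/-- **Uniqueness: every future unit normal field along `f` is `futureUnitNormal`** (pointwise uniqueness of the future unit
normal of a spacelike hyperplane, `TimeOrientation.eq_of_isFutureUnitNormal`). [cite: ONeill1983, Ch. 5, Lemma 5.26 and p. 145] -/
theorem eq_futureUnitNormal {ν : NormalField (𝓡 (n + 1)) f}
    (hν : 𝒮.metric.IsFutureUnitNormal (𝓡 n) 𝒮.timeOrientation f ν) (x : X') :
    ν x = futureUnitNormal 𝒮 f x := by
  have h := isFutureUnitNormal_futureUnitNormal 𝒮 hpos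
  exact 𝒮.timeOrientation.eq_of_isFutureUnitNormal rfl (mfderiv (𝓡 n) (𝓡 (n + 1)) f x)
    (fun v hv ↦ hpos x v hv) (DataEmbedding.finrank_tangentSpace_add_one (n := n) x)
    (h.1.1 x) (h.1.2 x) (h.2 x) (hν.1.1 x) (hν.1.2 x) (hν.2 x)

/-- **The transported unit normal `ν̃_{x₀}(x)` is the future unit normal `ν(x)`** on the two chart domains.
[cite: ONeill1983, Ch. 4, Lemma 4.19 ff.] -/
theorem smoothNormal_eq_futureUnitNormal {x : X'}
    (hxX : x ∈ (chartAt (EuclideanSpace ℝ (Fin n)) x₀).source)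
    (hxM : f x ∈ (chartAt (EuclideanSpace ℝ (Fin (n + 1))) (f x₀)).source) :
    smoothNormal 𝒮 f x₀ x = futureUnitNormal 𝒮 f x := by
  obtain ⟨huJ, huu, hu⟩ := smoothNormal_spec 𝒮 hpos hxX hxM
  have h := isFutureUnitNormal_futureUnitNormal 𝒮 hpos
  exact 𝒮.timeOrientation.eq_of_isFutureUnitNormal rfl (mfderiv (𝓡 n) (𝓡 (n + 1)) f x)
    (fun v hv ↦ hpos x v hv) (DataEmbedding.finrank_tangentSpace_add_one (n := n) x)
    (h.1.1 x) (h.1.2 x) (h.2 x) huJ huu hu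

/-! ### Smoothness of the coefficients and of the unit normal; assembly -/

include hf
variable (x₀)

/-- `c` is smooth at `x₀` (`contDiffAt_map_inverse` at the invertible `A(x₀)`). [folklore] -/
theorem contMDiffAt_coordCoeff :
    ContMDiffAt (𝓡 n) 𝓘(ℝ, EuclideanSpace ℝ (Fin n)) ∞ (coordCoeff 𝒮 f x₀) x₀ := by
  obtain ⟨e, he⟩ := isInvertible_coordOp 𝒮 hpos (x₀ := x₀) (mem_chart_source _ x₀)
    (mem_chart_source _ (f x₀))
  have h1 : ContDiffAt ℝ ∞ ContinuousLinearMap.inverse (coordOp 𝒮 f x₀ x₀) := by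
    rw [← he]
    exact contDiffAt_map_inverse e
  have h2 : ContMDiffAt (𝓡 n) 𝓘(ℝ, EuclideanSpace ℝ (Fin n) →L[ℝ] EuclideanSpace ℝ (Fin n)) ∞
      (fun x ↦ (coordOp 𝒮 f x₀ x).inverse) x₀ := h1.comp_contMDiffAt (contMDiffAt_coordOp 𝒮 x₀ hf)
  have h3 : ContMDiffAt (𝓡 n) 𝓘(ℝ, EuclideanSpace ℝ (Fin n)) ∞
      (fun x ↦ dualToVec n (coordFunctional 𝒮 f x₀ x)) x₀ :=
    contMDiffAt_const.clm_apply (contMDiffAt_coordFunctional 𝒮 x₀ hf)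
  exact h2.clm_apply h3

/-- `N` is smooth at `x₀`. [folklore] -/
theorem contMDiffAt_coordNormal :
    ContMDiffAt (𝓡 n) 𝓘(ℝ, EuclideanSpace ℝ (Fin (n + 1))) ∞ (coordNormal 𝒮 f x₀) x₀ :=
  (contMDiffAt_coordTime 𝒮 x₀ hf).sub ((contMDiffAt_coordDeriv 𝒮 x₀ hf).clm_apply
    (contMDiffAt_coordCoeff 𝒮 x₀ hf hpos))

/-- `ν̂` is smooth at `x₀` (`Ĝ(N, N) < 0` at `x₀`). [folklore] -/
theorem contMDiffAt_coordUnitNormal :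
    ContMDiffAt (𝓡 n) 𝓘(ℝ, EuclideanSpace ℝ (Fin (n + 1))) ∞ (coordUnitNormal 𝒮 f x₀) x₀ := by
  set ρ : X' → ℝ := fun x ↦ -(coordMetric 𝒮 f x₀ x (coordNormal 𝒮 f x₀ x) (coordNormal 𝒮 f x₀ x))
    with hρdef
  have hρ : ContMDiffAt (𝓡 n) 𝓘(ℝ, ℝ) ∞ ρ x₀ :=
    (((contMDiffAt_coordMetric 𝒮 x₀ hf).clm_apply (contMDiffAt_coordNormal 𝒮 x₀ hf hpos)).clm_apply
      (contMDiffAt_coordNormal 𝒮 x₀ hf hpos)).neg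
  have hρpos : 0 < ρ x₀ := by
    have h := coordMetric_coordNormal_self_neg 𝒮 hpos (x₀ := x₀) (mem_chart_source _ x₀)
      (mem_chart_source _ (f x₀))
    simp only [hρdef]
    linarith
  set σ : X' → ℝ := fun x ↦ Real.sqrt (ρ x) with hσdef
  have hsqrt : ContMDiffAt (𝓡 n) 𝓘(ℝ, ℝ) ∞ σ x₀ :=
    (Real.contDiffAt_sqrt (x := ρ x₀) hρpos.ne').comp_contMDiffAt hρ
  have hσpos : σ x₀ ≠ 0 := (Real.sqrt_pos.2 hρpos).ne'
  have hinv : ContMDiffAt (𝓡 n) 𝓘(ℝ, ℝ) ∞ (fun x ↦ (σ x)⁻¹) x₀ :=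
    (contDiffAt_inv ℝ hσpos).comp_contMDiffAt hsqrt
  exact hinv.smul (contMDiffAt_coordNormal 𝒮 x₀ hf hpos)

/-- **The future unit normal field is smooth along `f`**: `x ↦ (f x, ν x) : X → TM` is `C^∞` at every `x₀` (near `x₀` it is
the transported smooth field `ν̃_{x₀}`, `smoothNormal_eq_futureUnitNormal`). [cite: ONeill1983, Ch. 4, p. 99 and Lemma 4.19 ff.] -/
theorem contMDiffAt_futureUnitNormal :
    ContMDiffAt (𝓡 n) (𝓡 (n + 1)).tangent ∞
      (fun x ↦ (TotalSpace.mk' (EuclideanSpace ℝ (Fin (n + 1))) (f x) (futureUnitNormal 𝒮 f x) :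
        TangentBundle (𝓡 (n + 1)) 𝒮.carrier)) x₀ := by
  have hg1 : ∀ᶠ x in 𝓝 x₀, x ∈ (chartAt (EuclideanSpace ℝ (Fin n)) x₀).source :=
    (chartAt _ x₀).open_source.mem_nhds (mem_chart_source _ x₀)
  have hg2 : ∀ᶠ x in 𝓝 x₀, f x ∈ (chartAt (EuclideanSpace ℝ (Fin (n + 1))) (f x₀)).source :=
    (hf x₀).continuousAt.preimage_mem_nhds
      ((chartAt _ (f x₀)).open_source.mem_nhds (mem_chart_source _ (f x₀)))
  have hgood := hg1.and hg2
  have key : ContMDiffAt (𝓡 n) (𝓡 (n + 1)).tangent ∞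
      (fun x ↦ (TotalSpace.mk' (EuclideanSpace ℝ (Fin (n + 1))) (f x) (smoothNormal 𝒮 f x₀ x) :
        TangentBundle (𝓡 (n + 1)) 𝒮.carrier)) x₀ := by
    rw [contMDiffAt_totalSpace]
    refine ⟨hf x₀, ?_⟩
    refine (contMDiffAt_coordUnitNormal 𝒮 x₀ hf hpos).congr_of_eventuallyEq ?_
    filter_upwards [hgood] with x hx
    have hb := mem_baseSet_of_mem 𝒮 hx.2
    show ((trivializationAt (EuclideanSpace ℝ (Fin (n + 1))) (TangentSpace (𝓡 (n + 1)) : 𝒮.carrier → Type _) (f x₀))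
      (⟨f x, (trivializationAt (EuclideanSpace ℝ (Fin (n + 1))) (TangentSpace (𝓡 (n + 1)) : 𝒮.carrier → Type _)
        (f x₀)).symmL ℝ (f x) (coordUnitNormal 𝒮 f x₀ x)⟩ : TangentBundle (𝓡 (n + 1)) 𝒮.carrier)).2 =
        coordUnitNormal 𝒮 f x₀ x
    rw [Trivialization.symmL_apply _ hb]
    have h := Trivialization.apply_mk_symm (trivializationAt (EuclideanSpace ℝ (Fin (n + 1)))
      (TangentSpace (𝓡 (n + 1)) : 𝒮.carrier → Type _) (f x₀)) hb (coordUnitNormal 𝒮 f x₀ x)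
    exact (congrArg Prod.snd h).trans rfl
  refine key.congr_of_eventuallyEq ?_
  filter_upwards [hgood] with x hx
  show (TotalSpace.mk' (EuclideanSpace ℝ (Fin (n + 1))) (f x) (futureUnitNormal 𝒮 f x) :
      TangentBundle (𝓡 (n + 1)) 𝒮.carrier) =
    TotalSpace.mk' (EuclideanSpace ℝ (Fin (n + 1))) (f x) (smoothNormal 𝒮 f x₀ x)
  rw [smoothNormal_eq_futureUnitNormal 𝒮 hpos hx.1 hx.2]

/-- **The future unit normal field is a `C^∞` map `X → TM`.** [cite: ONeill1983, Ch. 4, p. 99 and Lemma 4.19 ff.] -/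
theorem contMDiff_futureUnitNormal :
    ContMDiff (𝓡 n) (𝓡 (n + 1)).tangent ∞
      (fun x ↦ (TotalSpace.mk' (EuclideanSpace ℝ (Fin (n + 1))) (f x) (futureUnitNormal 𝒮 f x) :
        TangentBundle (𝓡 (n + 1)) 𝒮.carrier)) := fun x ↦
  contMDiffAt_futureUnitNormal 𝒮 x hf hpos

/-- **Existence of a smooth future unit normal field** along a smooth map with positive-definite differential: there is a
field `ν` along `f` which is the future unit normal (`IsFutureUnitNormal`) and whose lift `x ↦ (f x, ν x)` is `C^∞`; it is
unique (`eq_futureUnitNormal`). [cite: ONeill1983, Ch. 4, p. 99 and Lemma 4.19 ff.; Ch. 5, p. 145] [cite: Wald1984, §10.2] -/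
theorem exists_isFutureUnitNormal_contMDiff :
    ∃ ν : NormalField (𝓡 (n + 1)) f,
      𝒮.metric.IsFutureUnitNormal (𝓡 n) 𝒮.timeOrientation f ν ∧
      ContMDiff (𝓡 n) (𝓡 (n + 1)).tangent ∞
        (fun x ↦ (TotalSpace.mk' (EuclideanSpace ℝ (Fin (n + 1))) (f x) (ν x) : TangentBundle (𝓡 (n + 1)) 𝒮.carrier)) :=
  ⟨futureUnitNormal 𝒮 f, isFutureUnitNormal_futureUnitNormal 𝒮 hpos, contMDiff_futureUnitNormal 𝒮 hf hpos⟩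

omit hf hpos

/-! ### Spacelike immersions -/

omit [IsManifold (𝓡 n) ∞ X'] in
/-- A spacelike immersion (`IsSpacelikeImmersion`: `C^∞` with positive-definite induced form) has positive-definite
differential in the sense used above. [cite: ONeill1983, Ch. 4, p. 97; Ch. 5, p. 142] -/
theorem val_mfderiv_pos_of_isSpacelikeImmersion (hsp : 𝒮.metric.toPseudoRiemannianMetric.IsSpacelikeImmersion (𝓡 n) f)
    (x : X') (v : TangentSpace (𝓡 n) x) (hv : v ≠ 0) :
    0 < 𝒮.metric.val (f x) (mfderiv (𝓡 n) (𝓡 (n + 1)) f x v) (mfderiv (𝓡 n) (𝓡 (n + 1)) f x v) :=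
  hsp.inducedBilin_pos x hv

/-- **A smooth spacelike immersion into a spacetime carries a unique smooth future unit normal field.**
[cite: ONeill1983, Ch. 4, p. 99 and Lemma 4.19 ff.; Ch. 5, Lemma 5.26 and p. 145] [cite: Wald1984, §10.2] -/
theorem exists_isFutureUnitNormal_contMDiff_of_isSpacelikeImmersion
    (hsp : 𝒮.metric.toPseudoRiemannianMetric.IsSpacelikeImmersion (𝓡 n) f) :
    ∃ ν : NormalField (𝓡 (n + 1)) f,
      𝒮.metric.IsFutureUnitNormal (𝓡 n) 𝒮.timeOrientation f ν ∧
      ContMDiff (𝓡 n) (𝓡 (n + 1)).tangent ∞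
        (fun x ↦ (TotalSpace.mk' (EuclideanSpace ℝ (Fin (n + 1))) (f x) (ν x) : TangentBundle (𝓡 (n + 1)) 𝒮.carrier)) :=
  exists_isFutureUnitNormal_contMDiff 𝒮 hsp.contMDiff_self (val_mfderiv_pos_of_isSpacelikeImmersion 𝒮 hsp)

/-- Uniqueness for spacelike immersions: any future unit normal field is `futureUnitNormal`. [cite: ONeill1983, Ch. 5, Lemma 5.26] -/
theorem eq_futureUnitNormal_of_isSpacelikeImmersion
    (hsp : 𝒮.metric.toPseudoRiemannianMetric.IsSpacelikeImmersion (𝓡 n) f) {ν : NormalField (𝓡 (n + 1)) f}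
    (hν : 𝒮.metric.IsFutureUnitNormal (𝓡 n) 𝒮.timeOrientation f ν) : ν = futureUnitNormal 𝒮 f :=
  funext fun x ↦ eq_futureUnitNormal 𝒮 (val_mfderiv_pos_of_isSpacelikeImmersion 𝒮 hsp) hν x

end Summit.FinalStateConjecture.FinalStateConjecture.Theorems.SpacelikeNormalField

end
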